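import Summits.Ventures.PackingBounds.Energy.NewtonCertificate

/-!
# Corrected Newton-form LP certificates (the 600-cell shape): all `k` at once

Framing: lottery ticket; floor = certified bounds/negative ranges. Venture `PackingBounds` (cell
`pub-packcert`, seat `pub-packcert-energy`), energy-minimisation family, **universal optimality
infrastructure**, companion of `NewtonCertificate.lean`.

For a configuration that is NOT sharp (the regular 600-cell: 8 inner products but only an
11-design — Cohn–Kumar 2007, §7) the plain Newton truncation of `(1+t)^k` has the wrong degree, and
one corrects the Newton partial products `ω_j` by multiples of the node polynomial `F = ω_{D₀}`:
`P_j = ω_j(1+t) - F(t) π_j(t)` with prescribed vanishing Gegenbauer coefficients. If every `P_j` is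
positive definite (`G ≥ 0`), every correction `π_j` is `≥ 0` on `[-1,1]`, `F ≥ 0`, and the design
identities hold with `P_j(1)`, then `h_k = Σ_j c_j(k) P_j` (the Newton coefficients `c_j(k) ≥ 0` of
`u^k`, `NewtonCert.newton_exists`) is an LP certificate proving the configuration's own
`(1+t)^k`-energy as lower bound, for every `k` (`NewtonCert.energy_ge_corrected`); the power-series
class follows by `NewtonCert.energy_ge_hasSum_of_pow`. Also: `ω_{2m} ≥ 0` for node sequences made of
adjacent equal pairs (`NewtonCert.omega_pairs_nonneg`).

## References
* H. Cohn, A. Kumar, *Universally optimal distribution of points on spheres*, J. Amer. Math. Soc.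
  20 (2007) 99–148, Thm. 1.2, Prop. 4.1, §§5–7. [`CohnKumar2006`]
-/

noncomputable section

namespace Summit.Ventures.PackingBounds.Energy

open Finset Literature.Analysis.SpecialFunctions Literature.Geometry.DiscreteGeometry

namespace NewtonCert

variable (v : ℕ → ℝ)

/-- For a node sequence made of adjacent equal pairs (`v_{2i} = v_{2i+1}`, `i < m`) the top Newton
polynomial is a product of squares: `ω_{2m}(u) = ∏_{i<m} (u - v_{2i})² ≥ 0`. [folklore] -/
theorem omega_pairs_nonneg (m : ℕ) (hpair : ∀ i < m, v (2 * i + 1) = v (2 * i)) (u : ℝ) :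
    0 ≤ ∏ i ∈ range (2 * m), (u - v i) := by
  induction m with
  | zero => simp
  | succ m ih =>
    rw [show 2 * (m + 1) = 2 * m + 1 + 1 by ring, Finset.prod_range_succ, Finset.prod_range_succ,
      hpair m (Nat.lt_succ_self m), mul_assoc, ← sq]
    exact mul_nonneg (ih fun i hi => hpair i (Nat.lt_succ_of_lt hi)) (sq_nonneg _)

open scoped Classical in
/-- **LP lower bound from a *corrected* Newton-form certificate** (the shape needed for the
600-cell, Cohn–Kumar 2007 §7, all `k` at once). As `NewtonCert.energy_ge`, but the positive definite
polynomials `P_j = Σ_i G_{j,i} C_i^{μ}` need only be *minorants* of the Newton partial products of a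
prescribed form: `ω_j(1+t) = P_j(t) + F(t) π_j(t)` with `F = ω_{D₀} ≥ 0` (so `F` vanishes at the
listed nodes) and `π_j ≥ 0` on `[-1,1]`. Then `h_k = Σ_j c_j(k) P_j ≤ Σ_j c_j(k) ω_j ≤ (1+t)^k`,
`h_k` agrees with `(1+t)^k` at the nodes, and the design identities
`N G_{j,0} = P_j(1) + Σ_{i<M} m_i ω_j(v_i)` make the bound `N Σ_i m_i v_i^k` for every `k`.
[cite: CohnKumar2006, Theorem 1.2, Proposition 4.1 and §§5–7] -/
theorem energy_ge_corrected {n : ℕ} {μ : ℝ} (hn : (n : ℝ) = 2 * μ + 2) (hμ : 0 < μ)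
    (D : ℕ) (hD : 1 ≤ D) (v : ℕ → ℝ) (hv : ∀ i, 0 ≤ v i)
    (hωD : ∀ u : ℝ, 0 ≤ u → 0 ≤ ∏ i ∈ range D, (u - v i))
    (D₀ : ℕ) (hD₀ : D₀ ≤ D) (F : ℝ → ℝ) (hF : ∀ t, 0 ≤ F t)
    (hFω : ∀ t, F t = ∏ i ∈ range D₀, (1 + t - v i))
    (π : ℕ → ℝ → ℝ) (hπ : ∀ j < D, ∀ t : ℝ, -1 ≤ t → t ≤ 1 → 0 ≤ π j t)
    (G : ℕ → ℕ → ℝ) (hG : ∀ j i, 0 ≤ G j i)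
    (hcorr : ∀ j < D, ∀ t : ℝ, ∏ i ∈ range j, (1 + t - v i) =
      ∑ i ∈ range D, G j i * gegenbauerSum μ i t + F t * π j t)
    (N M : ℕ) (hM : M ≤ D₀) (mult : ℕ → ℝ)
    (hdesign : ∀ j < D, (N : ℝ) * G j 0 = ∑ i ∈ range D, G j i * gegenbauerSum μ i 1 +
      ∑ i ∈ range M, mult i * ∏ i' ∈ range j, (v i - v i'))
    (k : ℕ) (C : Finset (EuclideanSpace ℝ (Fin n))) (h1 : ∀ x ∈ C, ‖x‖ = 1) (hN : C.card = N) :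
    (N : ℝ) * ∑ i ∈ range M, mult i * v i ^ k ≤
      ∑ x ∈ C, ∑ y ∈ C.erase x, (1 + inner ℝ x y) ^ k := by
  obtain ⟨c, r, hc, hr, hexp⟩ := newton_exists v hv D hD k
  set α : ℕ → ℝ := fun i => ∑ j ∈ range D, c j * G j i with hαdef
  have hα : ∀ i, 0 ≤ α i := fun i =>
    Finset.sum_nonneg fun j _ => mul_nonneg (hc j) (hG j i)
  -- `Σ_i α_i C_i(t) = Σ_j c_j P_j(t)`
  have hswap : ∀ t : ℝ, ∑ i ∈ range D, α i * gegenbauerSum μ i t =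
      ∑ j ∈ range D, c j * ∑ i ∈ range D, G j i * gegenbauerSum μ i t := by
    intro t
    calc ∑ i ∈ range D, α i * gegenbauerSum μ i t
          = ∑ i ∈ range D, ∑ j ∈ range D, c j * G j i * gegenbauerSum μ i t := by
            refine Finset.sum_congr rfl fun i _ => ?_
            rw [hαdef, Finset.sum_mul]
      _ = ∑ j ∈ range D, ∑ i ∈ range D, c j * G j i * gegenbauerSum μ i t :=
            Finset.sum_comm
      _ = ∑ j ∈ range D, c j * ∑ i ∈ range D, G j i * gegenbauerSum μ i t := by
            refine Finset.sum_congr rfl fun j _ => ?_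
            rw [Finset.mul_sum]
            exact Finset.sum_congr rfl fun i _ => by ring
  -- `P_j(t) = ω_j(1+t) - F(t) π_j(t)`
  have hP : ∀ j ∈ range D, ∀ t : ℝ, ∑ i ∈ range D, G j i * gegenbauerSum μ i t =
      ∏ i ∈ range j, (1 + t - v i) - F t * π j t := fun j hj t => by
    rw [hcorr j (Finset.mem_range.1 hj) t]; ring
  have hD' : D - 1 + 1 = D := Nat.sub_add_cancel hD
  have hH : ∀ t : ℝ, -1 ≤ t → t < 1 →
      ∑ i ∈ range (D - 1 + 1), α i * gegenbauerSum μ i t ≤ (fun t : ℝ => (1 + t) ^ k) t := by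
    intro t ht ht'
    rw [hD', hswap t]
    have hu : (0 : ℝ) ≤ 1 + t := by linarith
    dsimp only
    have hle : ∑ j ∈ range D, c j * ∑ i ∈ range D, G j i * gegenbauerSum μ i t ≤
        ∑ j ∈ range D, c j * ∏ i ∈ range j, (1 + t - v i) := by
      refine Finset.sum_le_sum fun j hj => ?_
      rw [hP j hj t]
      have h0 : 0 ≤ c j * (F t * π j t) :=
        mul_nonneg (hc j) (mul_nonneg (hF t) (hπ j (Finset.mem_range.1 hj) t ht ht'.le))
      nlinarith [h0]
    refine hle.trans ?_
    rw [hexp (1 + t)]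
    exact le_add_of_nonneg_right (mul_nonneg (hr _ hu) (hωD _ hu))
  have key := EnergyLP.energy_ge_inner hn hμ (D - 1) α hα (fun t : ℝ => (1 + t) ^ k) hH C h1
  have hα0 : α 0 = ∑ j ∈ range D, c j * G j 0 := by rw [hαdef]
  rw [hD', hN, hswap 1, hα0] at key
  refine le_trans (le_of_eq ?_) key
  -- evaluate the bound
  have hval : ∀ j ∈ range D, (N : ℝ) * G j 0 - ∑ i ∈ range D, G j i * gegenbauerSum μ i 1 =
      ∑ i ∈ range M, mult i * ∏ i' ∈ range j, (v i - v i') := fun j hj => by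
    rw [hdesign j (Finset.mem_range.1 hj)]; ring
  have hFnode : ∀ i ∈ range M, F (v i - 1) = 0 := fun i hi => by
    rw [hFω]
    have h := omega_node v (lt_of_lt_of_le (Finset.mem_range.1 hi) hM) (D := D₀)
    rw [← h]
    exact Finset.prod_congr rfl fun i' _ => by ring
  have hnode : ∀ i ∈ range M, ∑ j ∈ range D, c j * ∑ i' ∈ range D, G j i' *
      gegenbauerSum μ i' (v i - 1) = v i ^ k := by
    intro i hi
    have h := hexp (v i)
    rw [omega_node v (lt_of_lt_of_le (Finset.mem_range.1 hi) (hM.trans hD₀)), mul_zero,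
      add_zero] at h
    rw [h]
    refine Finset.sum_congr rfl fun j hj => ?_
    rw [hP j hj, hFnode i hi, zero_mul, sub_zero]
    congr 1
    exact Finset.prod_congr rfl fun i' _ => by ring
  calc (N : ℝ) * ∑ i ∈ range M, mult i * v i ^ k
        = (N : ℝ) * ∑ i ∈ range M, mult i *
            ∑ j ∈ range D, c j * ∏ i' ∈ range j, (v i - v i') := by
          congr 1
          refine Finset.sum_congr rfl fun i hi => ?_
          rw [← hnode i hi]
          congr 1
          refine Finset.sum_congr rfl fun j hj => ?_
          rw [hP j hj, hFnode i hi, zero_mul, sub_zero]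
          congr 1
          exact Finset.prod_congr rfl fun i' _ => by ring
    _ = (N : ℝ) * ∑ j ∈ range D, c j *
            ∑ i ∈ range M, mult i * ∏ i' ∈ range j, (v i - v i') := by
          congr 1
          rw [Finset.sum_congr rfl fun i _ => Finset.mul_sum (range D) _ (mult i), Finset.sum_comm]
          refine Finset.sum_congr rfl fun j _ => ?_
          rw [Finset.mul_sum]
          exact Finset.sum_congr rfl fun i _ => by ring
    _ = (N : ℝ) * ∑ j ∈ range D, c j *
            ((N : ℝ) * G j 0 - ∑ i ∈ range D, G j i * gegenbauerSum μ i 1) := by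
          congr 1; exact Finset.sum_congr rfl fun j hj => by rw [hval j hj]
    _ = (N : ℝ) ^ 2 * ∑ j ∈ range D, c j * G j 0 -
          (N : ℝ) * ∑ j ∈ range D, c j * ∑ i ∈ range D, G j i * gegenbauerSum μ i 1 := by
          rw [Finset.mul_sum, Finset.mul_sum, Finset.mul_sum, ← Finset.sum_sub_distrib]
          exact Finset.sum_congr rfl fun j _ => by ring

end NewtonCert

end Summit.Ventures.PackingBounds.Energy

end
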